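import Summits.Ventures.CertifiedManyBodySolver.Downfold.EmeryVanHoveSubBox
import HarnessLib

/-!
# The levers of the σ-model van Hove doping: `x_VH` is a monotone function of `u = 2(t_pp + t_pp′)/(Δ + ε_VH)` — it RISES with the
# oxygen–oxygen hoppings and FALLS with `Δ_pd` and `t_pd`

Venture CertifiedManyBodySolver, cell `pub/hubbard-downfold` (stage S1), seat hubbard-downfold-mod-4 (technique B); namespace
`Summit.Ventures.CertifiedManyBodySolver.Downfold.Emery`. Everything PROVED (corollaries of `EmeryVanHoveFactorisation` / `EmeryVanHoveSubBox`).
WHAT THIS IS NOT: a statement about any material; `U = 0` band kinematics; the comparison theorems assume both parameter points lie in the separated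
regime `VHSep` (certified per box by `vhBoxCheck`), `Δ ≥ 0`, `t_pp′ ≥ 0`, `t_pd ≠ 0`.

* `add_vhEnergy_mono_Delta`, `add_vhEnergy_mono_tpd`, `add_vhEnergy_anti_c` — `Δ + ε_VH(Δ, t_pd, t_pp′)` is increasing in `Δ` and in `t_pd ≥ 0` and
  decreasing in `t_pp′` (sqrt-free, from the corner lemmas `le_add_vhEnergy` / `add_vhEnergy_le`);
* `vhU_mono_tpp`, `vhU_mono_c`, `vhU_anti_Delta`, `vhU_anti_tpd` — the four partial monotonicities of `u`;
* `xVH_mono_of_vhU_le` — in the separated regime `u(p) ≤ u(p′) ⇒ x_VH(p) ≤ x_VH(p′)`; hence (`xVH_mono_tpp`, `xVH_anti_tpd`, …) THE LEVER LAWS: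
  more O–O hopping (or more axial admixture, which co-shifts `t_pp, t_pp′` upward — `EmeryAxialFermiSurfaceShape`) pushes the van Hove crossing to HIGHER hole
  doping; a larger `t_pd` (compression) or a larger charge-transfer energy pulls it DOWN — the certified content of the Hg-1201 @0 → @10 GPa census entry and of
  INFLATION-RULES-3to1-B §B.62's one-sided (upward) axial inflation.

Sources: [HybertsenSchluterChristensen1989, Eq. (1)]; [AndersenEtAl1995, §6]; [PavariniEtAl2001, Eq. (1)].
-/

noncomputable section

namespace Summit.Ventures.CertifiedManyBodySolver.Downfold.Emery

open Real Set

/-! ## `Δ + ε_VH` is monotone in `Δ`, `t_pd` and antitone in `t_pp′` -/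

/-- `Δ ↦ Δ + ε_VH` is increasing (`0 ≤ Δ₁ ≤ Δ₂`, `t_pp′ ≥ 0`). [folklore] -/
theorem add_vhEnergy_mono_Delta {Δ₁ Δ₂ tpd c : ℝ} (hΔ₁ : 0 ≤ Δ₁) (h : Δ₁ ≤ Δ₂) (hc : 0 ≤ c) :
    Δ₁ + vhEnergy Δ₁ tpd c ≤ Δ₂ + vhEnergy Δ₂ tpd c :=
  le_add_vhEnergy (A₁ := tpd ^ 2) hΔ₁ h le_rfl hc le_rfl (vhEnergy_nonneg _ _ _) (le_of_eq (vhEnergy_quad Δ₁ tpd c))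

/-- `t_pd ↦ Δ + ε_VH` is increasing on `t_pd ≥ 0` (`Δ ≥ 0`, `t_pp′ ≥ 0`). [folklore] -/
theorem add_vhEnergy_mono_tpd {Δ a₁ a₂ c : ℝ} (hΔ : 0 ≤ Δ) (ha₁ : 0 ≤ a₁) (h : a₁ ≤ a₂) (hc : 0 ≤ c) :
    Δ + vhEnergy Δ a₁ c ≤ Δ + vhEnergy Δ a₂ c :=
  le_add_vhEnergy (A₁ := a₁ ^ 2) hΔ le_rfl (pow_le_pow_left₀ ha₁ h 2) hc le_rfl (vhEnergy_nonneg _ _ _)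
    (le_of_eq (vhEnergy_quad Δ a₁ c))

/-- `t_pp′ ↦ Δ + ε_VH` is decreasing on `t_pp′ ≥ 0` (`Δ ≥ 0`). [folklore] -/
theorem add_vhEnergy_anti_c {Δ tpd c₁ c₂ : ℝ} (hΔ : 0 ≤ Δ) (hc₁ : 0 ≤ c₁) (h : c₁ ≤ c₂) :
    Δ + vhEnergy Δ tpd c₂ ≤ Δ + vhEnergy Δ tpd c₁ :=
  le_add_vhEnergy (A₁ := tpd ^ 2) hΔ le_rfl le_rfl hc₁ h (vhEnergy_nonneg _ _ _) (le_of_eq (vhEnergy_quad Δ tpd c₂))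

/-- `Δ + ε_VH > 0` for `Δ ≥ 0`, `t_pd ≠ 0`. [folklore] -/
theorem add_vhEnergy_pos {Δ tpd : ℝ} (hΔ : 0 ≤ Δ) (htpd : tpd ≠ 0) (c : ℝ) : 0 < Δ + vhEnergy Δ tpd c := by
  have := vhEnergy_pos Δ htpd c; linarith

/-! ## The four partial monotonicities of `u` -/

/-- `u` is increasing in `t_pp` (`Δ ≥ 0`, `t_pd ≠ 0`). [folklore] -/
theorem vhU_mono_tpp {Δ tpd c b₁ b₂ : ℝ} (hΔ : 0 ≤ Δ) (htpd : tpd ≠ 0) (h : b₁ ≤ b₂) :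
    vhU Δ tpd b₁ c ≤ vhU Δ tpd b₂ c := by
  rw [vhU_eq hΔ htpd, vhU_eq hΔ htpd]
  exact div_le_div_of_nonneg_right (by linarith) (add_vhEnergy_pos hΔ htpd c).le

/-- `u` is increasing in `t_pp′` on `0 ≤ t_pp′`, `t_pp′ + t_pp ≥ 0` (`Δ ≥ 0`, `t_pd ≠ 0`). [folklore] -/
theorem vhU_mono_c {Δ tpd tpp c₁ c₂ : ℝ} (hΔ : 0 ≤ Δ) (htpd : tpd ≠ 0) (hc₁ : 0 ≤ c₁) (h : c₁ ≤ c₂) (hct : 0 ≤ c₁ + tpp) :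
    vhU Δ tpd tpp c₁ ≤ vhU Δ tpd tpp c₂ := by
  rw [vhU_eq hΔ htpd, vhU_eq hΔ htpd]
  have hS₁ := add_vhEnergy_pos hΔ htpd c₁
  have hS₂ := add_vhEnergy_pos hΔ htpd c₂
  have hS := add_vhEnergy_anti_c (tpd := tpd) hΔ hc₁ h
  rw [div_le_div_iff₀ hS₁ hS₂]
  have e1 : 2 * (c₁ + tpp) * (Δ + vhEnergy Δ tpd c₂) ≤ 2 * (c₁ + tpp) * (Δ + vhEnergy Δ tpd c₁) :=
    mul_le_mul_of_nonneg_left hS (by linarith)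
  have e2 : 2 * (c₁ + tpp) * (Δ + vhEnergy Δ tpd c₁) ≤ 2 * (c₂ + tpp) * (Δ + vhEnergy Δ tpd c₁) :=
    mul_le_mul_of_nonneg_right (by linarith) hS₁.le
  linarith

/-- `u` is decreasing in `Δ` on `Δ ≥ 0` (`t_pd ≠ 0`, `t_pp′ ≥ 0`, `t_pp′ + t_pp ≥ 0`). [folklore] -/
theorem vhU_anti_Delta {Δ₁ Δ₂ tpd tpp c : ℝ} (hΔ₁ : 0 ≤ Δ₁) (h : Δ₁ ≤ Δ₂) (htpd : tpd ≠ 0) (hc : 0 ≤ c) (hct : 0 ≤ c + tpp) :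
    vhU Δ₂ tpd tpp c ≤ vhU Δ₁ tpd tpp c := by
  rw [vhU_eq hΔ₁ htpd, vhU_eq (hΔ₁.trans h) htpd]
  exact div_le_div_of_nonneg_left (by linarith) (add_vhEnergy_pos hΔ₁ htpd c) (add_vhEnergy_mono_Delta hΔ₁ h hc)

/-- `u` is decreasing in `t_pd` on `t_pd > 0` (`Δ ≥ 0`, `t_pp′ ≥ 0`, `t_pp′ + t_pp ≥ 0`). [folklore] -/
theorem vhU_anti_tpd {Δ a₁ a₂ tpp c : ℝ} (hΔ : 0 ≤ Δ) (ha₁ : 0 < a₁) (h : a₁ ≤ a₂) (hc : 0 ≤ c) (hct : 0 ≤ c + tpp) :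
    vhU Δ a₂ tpp c ≤ vhU Δ a₁ tpp c := by
  rw [vhU_eq hΔ ha₁.ne', vhU_eq hΔ (ha₁.trans_le h).ne']
  exact div_le_div_of_nonneg_left (by linarith) (add_vhEnergy_pos hΔ ha₁.ne' c) (add_vhEnergy_mono_tpd hΔ ha₁.le h hc)

/-! ## `x_VH` is monotone in `u` (separated regime) — the lever laws -/

/-- In the separated regime (`VHSep` at both points, `Δ, Δ′ ≥ 0`, `t_pp′, t_pp′′ ≥ 0`, `u, u′ ≥ 0`, `t_pd, t_pd′ ≠ 0`):
`u(p) ≤ u(p′) ⇒ x_VH(p) ≤ x_VH(p′)`. [folklore] -/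
theorem xVH_mono_of_vhU_le {Δ tpd tpp c Δ' tpd' tpp' c' : ℝ} (hΔ : 0 ≤ Δ) (hc : 0 ≤ c) (htpd : tpd ≠ 0)
    (hu0 : 0 ≤ vhU Δ tpd tpp c) (hsep : VHSep Δ tpd tpp c) (hΔ' : 0 ≤ Δ') (hc' : 0 ≤ c') (htpd' : tpd' ≠ 0)
    (hsep' : VHSep Δ' tpd' tpp' c') (hu : vhU Δ tpd tpp c ≤ vhU Δ' tpd' tpp' c') :
    xVH Δ tpd tpp c ≤ xVH Δ' tpd' tpp' c' := by
  obtain ⟨hw, hD⟩ := fsD_vh_pos hΔ htpd c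
  obtain ⟨hw', hD'⟩ := fsD_vh_pos hΔ' htpd' c'
  have hq : vhRatio Δ tpd tpp c = vhU Δ tpd tpp c * (1 + vhU Δ tpd tpp c) := vhRatio_eq_vhU htpd hw.ne'
  have hq' : vhRatio Δ' tpd' tpp' c' = vhU Δ' tpd' tpp' c' * (1 + vhU Δ' tpd' tpp' c') := vhRatio_eq_vhU htpd' hw'.ne'
  have hu0' : 0 ≤ vhU Δ' tpd' tpp' c' := hu0.trans hu
  have hq0 : 0 ≤ vhRatio Δ tpd tpp c := by rw [hq]; exact mul_nonneg hu0 (by linarith)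
  have hq0' : 0 ≤ vhRatio Δ' tpd' tpp' c' := by rw [hq']; exact mul_nonneg hu0' (by linarith)
  have hqq : vhRatio Δ tpd tpp c ≤ vhRatio Δ' tpd' tpp' c' := by rw [hq, hq']; exact mul_one_add_mono hu0 hu
  rw [xVH_eq hΔ hc hD hq0 hsep, xVH_eq hΔ' hc' hD' hq0' hsep']
  linarith [vhFrac_anti hqq]

/-- LEVER LAW (O–O hopping): raising `t_pp` raises `x_VH` (separated regime at both points). [folklore] -/
theorem xVH_mono_tpp {Δ tpd c b₁ b₂ : ℝ} (hΔ : 0 ≤ Δ) (hc : 0 ≤ c) (htpd : tpd ≠ 0) (hb₁ : 0 ≤ c + b₁) (h : b₁ ≤ b₂)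
    (hsep₁ : VHSep Δ tpd b₁ c) (hsep₂ : VHSep Δ tpd b₂ c) : xVH Δ tpd b₁ c ≤ xVH Δ tpd b₂ c := by
  have hu0 : 0 ≤ vhU Δ tpd b₁ c := by
    rw [vhU_eq hΔ htpd]; exact div_nonneg (by linarith) (add_vhEnergy_pos hΔ htpd c).le
  exact xVH_mono_of_vhU_le hΔ hc htpd hu0 hsep₁ hΔ hc htpd hsep₂ (vhU_mono_tpp hΔ htpd h)

/-- LEVER LAW (charge-transfer energy): raising `Δ` lowers `x_VH` (separated regime at both points). [folklore] -/
theorem xVH_anti_Delta {Δ₁ Δ₂ tpd tpp c : ℝ} (hΔ₁ : 0 ≤ Δ₁) (h : Δ₁ ≤ Δ₂) (hc : 0 ≤ c) (htpd : tpd ≠ 0) (hct : 0 ≤ c + tpp)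
    (hsep₁ : VHSep Δ₁ tpd tpp c) (hsep₂ : VHSep Δ₂ tpd tpp c) : xVH Δ₂ tpd tpp c ≤ xVH Δ₁ tpd tpp c := by
  have hΔ₂ : 0 ≤ Δ₂ := hΔ₁.trans h
  have hu0 : 0 ≤ vhU Δ₂ tpd tpp c := by
    rw [vhU_eq hΔ₂ htpd]; exact div_nonneg (by linarith) (add_vhEnergy_pos hΔ₂ htpd c).le
  exact xVH_mono_of_vhU_le hΔ₂ hc htpd hu0 hsep₂ hΔ₁ hc htpd hsep₁ (vhU_anti_Delta hΔ₁ h htpd hc hct)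

/-- LEVER LAW (d–p hopping, the compression lever): raising `t_pd` lowers `x_VH` (separated regime at both points). [folklore] -/
theorem xVH_anti_tpd {Δ a₁ a₂ tpp c : ℝ} (hΔ : 0 ≤ Δ) (ha₁ : 0 < a₁) (h : a₁ ≤ a₂) (hc : 0 ≤ c) (hct : 0 ≤ c + tpp)
    (hsep₁ : VHSep Δ a₁ tpp c) (hsep₂ : VHSep Δ a₂ tpp c) : xVH Δ a₂ tpp c ≤ xVH Δ a₁ tpp c := by
  have ha₂ : a₂ ≠ 0 := (ha₁.trans_le h).ne'
  have hu0 : 0 ≤ vhU Δ a₂ tpp c := by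
    rw [vhU_eq hΔ ha₂]; exact div_nonneg (by linarith) (add_vhEnergy_pos hΔ ha₂ c).le
  exact xVH_mono_of_vhU_le hΔ hc ha₂ hu0 hsep₂ hΔ hc ha₁.ne' hsep₁ (vhU_anti_tpd hΔ ha₁ h hc hct)

/-- LEVER LAW (across-Cu O–O hopping / axial co-shift direction): raising `t_pp′` raises `x_VH` (separated regime at both points). [folklore] -/
theorem xVH_mono_c {Δ tpd tpp c₁ c₂ : ℝ} (hΔ : 0 ≤ Δ) (htpd : tpd ≠ 0) (hc₁ : 0 ≤ c₁) (h : c₁ ≤ c₂) (hct : 0 ≤ c₁ + tpp)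
    (hsep₁ : VHSep Δ tpd tpp c₁) (hsep₂ : VHSep Δ tpd tpp c₂) : xVH Δ tpd tpp c₁ ≤ xVH Δ tpd tpp c₂ := by
  have hu0 : 0 ≤ vhU Δ tpd tpp c₁ := by
    rw [vhU_eq hΔ htpd]; exact div_nonneg (by linarith) (add_vhEnergy_pos hΔ htpd c₁).le
  exact xVH_mono_of_vhU_le hΔ hc₁ htpd hu0 hsep₁ hΔ (hc₁.trans h) htpd hsep₂ (vhU_mono_c hΔ htpd hc₁ h hct)

end Summit.Ventures.CertifiedManyBodySolver.Downfold.Emery
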